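import Summits.CriticalPhenomena.SAWScalingLimit.Theses.SAWDefectDecoherence
import Summits.CriticalPhenomena.SAWScalingLimit.Theorems.BoundaryClosureNegative_Endgame

/-!
# `BoundaryClosureR`, line `pick-half-plane`, stub `stub_identification`: the identification
# statement is implied by the target (consistency certificate) and the weak limit is unique

Support file for the crux `BoundaryClosureR` (stmt-CriticalPhenomena-14004) of route
`SAWDefectDecoherence`, line `pick-half-plane`, stub `stub_identification :
PickCupLimits → Identification` (skeleton `Cruxes/BoundaryClosureR/Lines/pick-half-plane.lean`,
namespace `…Cruxes.BoundaryClosureR.PickHalfPlane`).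

Two provable pieces of the identification step, in tree vocabulary (the line-local abbreviations
`IsTest`, `NF`, `IsWeakLimit`, `AdmissibleFamily`, `PinnedFlatRoot`, `flatPoints`,
`IsPickCupLimit`, `Identification` of the skeleton are UNFOLDED verbatim, so that in the skeleton
`exact identification_of_hexObservableLimitR h` has type `Identification` by `δ`-unfolding):

* `eqOn_of_integral_mul_eq` — the **fundamental lemma of the calculus of variations for
  continuous test functions**, two-function form: two functions continuous on an open `U ⊆ ℂ`
  with the same integrals against every continuous compactly supported `ψ` with `tsupport ψ ⊆ U`
  agree on `U` (subtract — the products are integrable — and apply the tree's one-function form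
  `BoundaryClosure.Negative.eq_zero_of_forall_integral`, a bump-function argument). Consequently a weak limit in the sense of the line (`IsWeakLimit`: convergence of the
  normalised functionals against ALL bulk test functions) that is continuous on the carrier — in
  particular a holomorphic Pick–cup limit — is determined POINTWISE on the open carrier, not
  just a.e.; `weakLimit_unique`: two such weak limits along the same mesh sequence coincide.
* `identification_of_hexObservableLimitR` — **the target implies the identification stub's
  conclusion with the same constant**: if `HexObservableLimitR` holds with constant `c`, then
  every weak limit `g` (continuous on the carrier) of the normalised functionals of an
  admissible family with the root pinned at `D.pt 0`, along any mesh sequence `ns → 0⁺`, IS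
  `c · exp((5/8)(L - L_b))` on the carrier, for every admissible choice of `(Φ, L, L_b)`.
  Together with the skeleton's sorry-free `closing : PickCupLimits → Identification →
  HexObservableLimitR` this pins the stub exactly: GIVEN `PickCupLimits`,
  `Identification ↔ HexObservableLimitR`.  In particular `Identification` is consistent
  (it follows from Duminil-Copin–Smirnov's Conjecture 2 in the repaired averaged form), the
  `∃ c` BEFORE `∀ D` is forced by the target, and no configuration-dependent unit (east/west
  position of the root relative to the normaliser, floors at different heights) can be hiding in
  `c`: whatever phase bookkeeping the target's continuous branch `L` of `log Φ'` does, the stub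
  does the same.

No new definitions; nothing here is specific to the Pick lever.

References: Duminil-Copin–Smirnov, *Ann. of Math.* 175 (2012), Conjecture 2 (the target);
the fundamental lemma is folklore (e.g. Hörmander, *ALPDO I*, Thm. 1.2.5).
-/

noncomputable section

open scoped BigOperators ComplexConjugate Topology
open Filter Set MeasureTheory
open Literature.Probability.LatticeModels Literature.Probability.RandomPlanarGeometry
open Literature.Probability.RandomPlanarGeometry.SAW
open Summit.CriticalPhenomena.SAWScalingLimit.Theses.SAWDefectDecoherence

namespace Summit.CriticalPhenomena.SAWScalingLimit.Theorems.PickHalfPlane.Identification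

/-! ### The fundamental lemma for continuous test functions -/

/-- A continuous compactly supported test function times a function continuous on an open set
containing the test function's topological support is integrable (it is continuous on the plane,
`BoundaryClosure.Negative.continuous_mul_of_tsupport_subset`, and compactly supported). [folklore] -/
theorem integrable_test_mul {U : Set ℂ} (hU : IsOpen U) {ψ g : ℂ → ℂ} (hψ : Continuous ψ)
    (hψK : HasCompactSupport ψ) (hψU : tsupport ψ ⊆ U) (hg : ContinuousOn g U) :
    Integrable fun z => ψ z * g z :=
  (BoundaryClosure.Negative.continuous_mul_of_tsupport_subset hU hψ hψU hg).integrable_of_hasCompactSupport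
    hψK.mul_right

/-- **Fundamental lemma of the calculus of variations, continuous test functions, two-function
pointwise form.** If `g, g'` are continuous on an open set `U ⊆ ℂ` and `∫ ψ g = ∫ ψ g'` for every
continuous compactly supported `ψ : ℂ → ℂ` with `tsupport ψ ⊆ U`, then `g = g'` on `U`: the
products being integrable, `∫ ψ (g - g') = 0` for all such `ψ`, and the tree's one-function form
`BoundaryClosure.Negative.eq_zero_of_forall_integral` (test against a bump times
`conj (g - g')(z₀)`) gives `g - g' = 0` on `U`. [folklore] -/
theorem eqOn_of_integral_mul_eq {U : Set ℂ} (hU : IsOpen U) {g g' : ℂ → ℂ}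
    (hg : ContinuousOn g U) (hg' : ContinuousOn g' U)
    (h : ∀ ψ : ℂ → ℂ, Continuous ψ → HasCompactSupport ψ → tsupport ψ ⊆ U →
      ∫ z, ψ z * g z = ∫ z, ψ z * g' z) :
    EqOn g g' U := by
  have key : ∀ ψ : ℂ → ℂ, Continuous ψ → HasCompactSupport ψ → tsupport ψ ⊆ U →
      ∫ z, ψ z * (g z - g' z) = 0 := by
    intro ψ hψc hψK hψU
    have h1 := integrable_test_mul hU hψc hψK hψU hg
    have h2 := integrable_test_mul hU hψc hψK hψU hg'
    calc ∫ z, ψ z * (g z - g' z) = ∫ z, (ψ z * g z - ψ z * g' z) := by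
          refine integral_congr_ae (Eventually.of_forall fun z => ?_)
          simp only [mul_sub]
      _ = (∫ z, ψ z * g z) - ∫ z, ψ z * g' z := integral_sub h1 h2
      _ = 0 := by rw [h ψ hψc hψK hψU, sub_self]
  intro z hz
  exact sub_eq_zero.1
    (BoundaryClosure.Negative.eq_zero_of_forall_integral hU (hg.sub hg') key hz)

/-- **Weak limits along a mesh sequence are unique among functions continuous on the carrier.**
If the normalised functionals `N_{ns n}(ψ)` (any complex sequence of functionals of the test
function) converge both to `∫ ψ g` and to `∫ ψ g'` for every bulk test function `ψ`
(continuous, compactly supported, `tsupport ψ ⊆ U`), and `g, g'` are continuous on the open set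
`U`, then `g = g'` on `U` (uniqueness of limits in `ℂ` and `eqOn_of_integral_mul_eq`).  In the
line: two Pick–cup (or interior Pick) limits extracted along the SAME subsequence coincide on the
carrier. [folklore] -/
theorem weakLimit_unique {U : Set ℂ} (hU : IsOpen U) {N : ℕ → (ℂ → ℂ) → ℂ} {g g' : ℂ → ℂ}
    (hg : ContinuousOn g U) (hg' : ContinuousOn g' U)
    (hw : ∀ ψ : ℂ → ℂ, (Continuous ψ ∧ HasCompactSupport ψ ∧ tsupport ψ ⊆ U) →
      Tendsto (fun n => N n ψ) atTop (𝓝 (∫ z, ψ z * g z)))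
    (hw' : ∀ ψ : ℂ → ℂ, (Continuous ψ ∧ HasCompactSupport ψ ∧ tsupport ψ ⊆ U) →
      Tendsto (fun n => N n ψ) atTop (𝓝 (∫ z, ψ z * g' z))) :
    EqOn g g' U :=
  eqOn_of_integral_mul_eq hU hg hg' fun ψ hψc hψK hψU =>
    tendsto_nhds_unique (hw ψ ⟨hψc, hψK, hψU⟩) (hw' ψ ⟨hψc, hψK, hψU⟩)

/-! ### The target identifies every weak limit -/

/-- **Weak limits are identified by the target.** If `HexObservableLimitR` holds with constant
`c`, i.e. the normalised functionals `δ² Σ ψ F_δ / F_δ(b_δ)` converge along `𝓝[>] 0` for every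
admissible datum, then along every mesh sequence `ns → 0⁺` a function `g` continuous on the
carrier against which the functionals converge weakly (all bulk test functions) equals
`c · exp((5/8)(L - L_b))` on the carrier: limits in `ℂ` are unique and the fundamental lemma
(`eqOn_of_integral_mul_eq`) applies, the right-hand side being continuous on the carrier.
The hypotheses are those of the target with the two pin radii allowed to differ (`ρ` at the
normaliser, `r₀` at the root; the target is applied with `min ρ r₀`). [folklore] -/
theorem weakLimit_eq_of_hexObservableLimitR {c : ℂ}
    (hT : ∀ (D : DobrushinDomain) (ρ : ℝ) (Λ : ℝ → Finset HexVertex) (m : Fin 2 → ℝ → ℤ)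
      (a b : ℝ → Sym2 HexVertex) (Φ : ConformalEquiv D.carrier UpperHalfPlane.upperHalfPlaneSet)
      (L : ℂ → ℂ) (Lb : ℂ) (ψ : ℂ → ℂ),
      let F : ℝ → Sym2 HexVertex → ℂ := fun δ z =>
        hexParafermionicObservable (Λ δ) (a δ) hexCriticalFugacity (5 / 8) z
      0 < ρ →
      (∀ i : Fin 2, D.carrier ∩ Metric.ball (D.pt i) ρ =
        {z : ℂ | (D.pt i).im < z.im} ∩ Metric.ball (D.pt i) ρ) →
      (∀ᶠ δ : ℝ in 𝓝[>] 0, hexDomainSimplyConnected (Λ δ) ∧ a δ ∈ hexDomainBoundary (Λ δ) ∧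
        b δ ∈ hexDomainBoundary (Λ δ) ∧ Nonempty (HexMidEdgeSAW (Λ δ) (a δ) (b δ)) ∧
        (hexGraph.induce ((Λ δ : Finset HexVertex) : Set HexVertex)).Preconnected ∧
        (∀ v ∈ Λ δ, (δ : ℂ) * hexCenter v ∈ D.carrier) ∧
        (∀ i : Fin 2, ∀ v : HexVertex, (δ : ℂ) * hexCenter v ∈ Metric.ball (D.pt i) ρ →
          (v ∈ Λ δ ↔ m i δ ≤ v.1 1))) →
      (∀ K : Set ℂ, IsCompact K → K ⊆ D.carrier →
        ∀ᶠ δ : ℝ in 𝓝[>] 0, ∀ v : HexVertex, (δ : ℂ) * hexCenter v ∈ K → v ∈ Λ δ) →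
      Tendsto (fun δ : ℝ => (δ : ℂ) * hexMidpoint (a δ)) (𝓝[>] 0) (𝓝 (D.pt 0)) →
      Tendsto (fun δ : ℝ => (δ : ℂ) * hexMidpoint (b δ)) (𝓝[>] 0) (𝓝 (D.pt 1)) →
      Tendsto (fun x => ‖Φ x‖) (𝓝[D.carrier] (D.pt 0)) atTop → Φ.HasBoundaryValue (D.pt 1) 0 →
      ContinuousOn L D.carrier → (∀ z ∈ D.carrier, Complex.exp (L z) = deriv Φ z) →
      Tendsto L (𝓝[D.carrier] (D.pt 1)) (𝓝 Lb) →
      Continuous ψ → HasCompactSupport ψ → tsupport ψ ⊆ D.carrier →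
      Tendsto (fun δ : ℝ => (δ : ℂ) ^ 2 *
          (∑ᶠ e ∈ hexDomainMidEdges (Λ δ), ψ ((δ : ℂ) * hexMidpoint e) * F δ e) / F δ (b δ))
        (𝓝[>] 0) (𝓝 (c * ∫ z, ψ z * Complex.exp ((5 / 8 : ℂ) * (L z - Lb)))))
    (D : DobrushinDomain) (ρ : ℝ) (Λ : ℝ → Finset HexVertex) (m : ℝ → ℤ) (b : ℝ → Sym2 HexVertex)
    (hAF : 0 < ρ ∧
      D.carrier ∩ Metric.ball (D.pt 1) ρ = {z : ℂ | (D.pt 1).im < z.im} ∩ Metric.ball (D.pt 1) ρ ∧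
      (∀ᶠ δ : ℝ in 𝓝[>] 0, hexDomainSimplyConnected (Λ δ) ∧ b δ ∈ hexDomainBoundary (Λ δ) ∧
          (hexGraph.induce ((Λ δ : Finset HexVertex) : Set HexVertex)).Preconnected ∧
          (∀ v ∈ Λ δ, (δ : ℂ) * hexCenter v ∈ D.carrier) ∧
          (∀ v : HexVertex, (δ : ℂ) * hexCenter v ∈ Metric.ball (D.pt 1) ρ →
            (v ∈ Λ δ ↔ m δ ≤ v.1 1))) ∧
      (∀ K : Set ℂ, IsCompact K → K ⊆ D.carrier →
          ∀ᶠ δ : ℝ in 𝓝[>] 0, ∀ v : HexVertex, (δ : ℂ) * hexCenter v ∈ K → v ∈ Λ δ) ∧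
      Tendsto (fun δ : ℝ => (δ : ℂ) * hexMidpoint (b δ)) (𝓝[>] 0) (𝓝 (D.pt 1)))
    (a : ℝ → Sym2 HexVertex) (r₀ : ℝ) (m₀ : ℝ → ℤ)
    (hPR : 0 < r₀ ∧
      D.carrier ∩ Metric.ball (D.pt 0) r₀ = {z : ℂ | (D.pt 0).im < z.im} ∩ Metric.ball (D.pt 0) r₀ ∧
      (∀ᶠ δ : ℝ in 𝓝[>] 0, a δ ∈ hexDomainBoundary (Λ δ) ∧
          Nonempty (HexMidEdgeSAW (Λ δ) (a δ) (b δ)) ∧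
          (∀ v : HexVertex, (δ : ℂ) * hexCenter v ∈ Metric.ball (D.pt 0) r₀ →
            (v ∈ Λ δ ↔ m₀ δ ≤ v.1 1))) ∧
      Tendsto (fun δ : ℝ => (δ : ℂ) * hexMidpoint (a δ)) (𝓝[>] 0) (𝓝 (D.pt 0)))
    (Φ : ConformalEquiv D.carrier UpperHalfPlane.upperHalfPlaneSet) (L : ℂ → ℂ) (Lb : ℂ)
    (hΦ : Tendsto (fun z => ‖Φ z‖) (𝓝[D.carrier] (D.pt 0)) atTop)
    (hΦb : Φ.HasBoundaryValue (D.pt 1) 0)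
    (hL : ContinuousOn L D.carrier) (hexpL : ∀ z ∈ D.carrier, Complex.exp (L z) = deriv Φ z)
    (hLb : Tendsto L (𝓝[D.carrier] (D.pt 1)) (𝓝 Lb))
    (ns : ℕ → ℝ) (hns : Tendsto ns atTop (𝓝[>] 0))
    (g : ℂ → ℂ) (hg : ContinuousOn g D.carrier)
    (hw : ∀ ψ : ℂ → ℂ, (Continuous ψ ∧ HasCompactSupport ψ ∧ tsupport ψ ⊆ D.carrier) →
      Tendsto (fun n => ((ns n : ℝ) : ℂ) ^ 2 * (∑ᶠ z ∈ hexDomainMidEdges (Λ (ns n)),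
          ψ (((ns n : ℝ) : ℂ) * hexMidpoint z) *
            hexParafermionicObservable (Λ (ns n)) (a (ns n)) hexCriticalFugacity (5 / 8) z) /
        hexParafermionicObservable (Λ (ns n)) (a (ns n)) hexCriticalFugacity (5 / 8) (b (ns n)))
        atTop (𝓝 (∫ z, ψ z * g z))) :
    ∀ z ∈ D.carrier, g z = c * Complex.exp ((5 / 8 : ℂ) * (L z - Lb)) := by
  obtain ⟨hρ, hflat1, hadm1, hexh, hb⟩ := hAF
  obtain ⟨hr₀, hflat0, hadm0, ha⟩ := hPR
  -- the common pin radius and the two row functions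
  set ρ' : ℝ := min ρ r₀ with hρ'def
  have hρ' : 0 < ρ' := lt_min hρ hr₀
  set m' : Fin 2 → ℝ → ℤ := ![m₀, m] with hm'def
  have hball0 : Metric.ball (D.pt 0) ρ' ⊆ Metric.ball (D.pt 0) r₀ :=
    Metric.ball_subset_ball (min_le_right _ _)
  have hball1 : Metric.ball (D.pt 1) ρ' ⊆ Metric.ball (D.pt 1) ρ :=
    Metric.ball_subset_ball (min_le_left _ _)
  have hflat : ∀ i : Fin 2, D.carrier ∩ Metric.ball (D.pt i) ρ' =
      {z : ℂ | (D.pt i).im < z.im} ∩ Metric.ball (D.pt i) ρ' := by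
    refine Fin.forall_fin_two.2 ⟨?_, ?_⟩
    · ext w
      constructor
      · rintro ⟨hw, hw'⟩
        have : w ∈ D.carrier ∩ Metric.ball (D.pt 0) r₀ := ⟨hw, hball0 hw'⟩
        rw [hflat0] at this
        exact ⟨this.1, hw'⟩
      · rintro ⟨hw, hw'⟩
        have : w ∈ {z : ℂ | (D.pt 0).im < z.im} ∩ Metric.ball (D.pt 0) r₀ := ⟨hw, hball0 hw'⟩
        rw [← hflat0] at this
        exact ⟨this.1, hw'⟩
    · ext w
      constructor
      · rintro ⟨hw, hw'⟩
        have : w ∈ D.carrier ∩ Metric.ball (D.pt 1) ρ := ⟨hw, hball1 hw'⟩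
        rw [hflat1] at this
        exact ⟨this.1, hw'⟩
      · rintro ⟨hw, hw'⟩
        have : w ∈ {z : ℂ | (D.pt 1).im < z.im} ∩ Metric.ball (D.pt 1) ρ := ⟨hw, hball1 hw'⟩
        rw [← hflat1] at this
        exact ⟨this.1, hw'⟩
  have hadm : ∀ᶠ δ : ℝ in 𝓝[>] 0, hexDomainSimplyConnected (Λ δ) ∧ a δ ∈ hexDomainBoundary (Λ δ) ∧
      b δ ∈ hexDomainBoundary (Λ δ) ∧ Nonempty (HexMidEdgeSAW (Λ δ) (a δ) (b δ)) ∧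
      (hexGraph.induce ((Λ δ : Finset HexVertex) : Set HexVertex)).Preconnected ∧
      (∀ v ∈ Λ δ, (δ : ℂ) * hexCenter v ∈ D.carrier) ∧
      (∀ i : Fin 2, ∀ v : HexVertex, (δ : ℂ) * hexCenter v ∈ Metric.ball (D.pt i) ρ' →
        (v ∈ Λ δ ↔ m' i δ ≤ v.1 1)) := by
    filter_upwards [hadm1, hadm0] with δ h1 h0
    refine ⟨h1.1, h0.1, h1.2.1, h0.2.1, h1.2.2.1, h1.2.2.2.1, Fin.forall_fin_two.2 ⟨?_, ?_⟩⟩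
    · intro v hv
      exact h0.2.2 v (hball0 hv)
    · intro v hv
      exact h1.2.2.2.2 v (hball1 hv)
  -- the right-hand side is continuous on the carrier
  have hE : ContinuousOn (fun z => c * Complex.exp ((5 / 8 : ℂ) * (L z - Lb))) D.carrier :=
    continuousOn_const.mul ((continuousOn_const.mul (hL.sub continuousOn_const)).cexp)
  refine eqOn_of_integral_mul_eq D.isOpen hg hE fun ψ hψc hψK hψD => ?_
  -- the target along the mesh sequence, and uniqueness of limits
  have h1 := (hT D ρ' Λ m' a b Φ L Lb ψ hρ' hflat hadm hexh ha hb hΦ hΦb hL hexpL hLb hψc hψK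
    hψD).comp hns
  have h2 := hw ψ ⟨hψc, hψK, hψD⟩
  have h3 : ∫ z, ψ z * g z = c * ∫ z, ψ z * Complex.exp ((5 / 8 : ℂ) * (L z - Lb)) :=
    tendsto_nhds_unique h2 h1
  rw [h3, ← integral_const_mul]
  refine integral_congr_ae (Eventually.of_forall fun z => ?_)
  simp only
  ring

/-- **The target implies the identification stub's conclusion (consistency certificate for
`stub_identification` of line `pick-half-plane`).** The conclusion is VERBATIM the line-local
statement `Identification` of `Cruxes/BoundaryClosureR/Lines/pick-half-plane.lean` with its
abbreviations (`AdmissibleFamily`, `PinnedFlatRoot`, `IsPickCupLimit`, `flatPoints`,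
`IsWeakLimit`, `IsTest`, `NF`) unfolded, so that in the skeleton
`example (h : HexObservableLimitR) : Identification := identification_of_hexObservableLimitR h`
elaborates by unfolding.  With the skeleton's `closing : PickCupLimits → Identification →
HexObservableLimitR` this shows: given `PickCupLimits`, `Identification ↔ HexObservableLimitR`,
with the SAME universal constant `c` — the stub is exactly as strong as the target, its `∃ c`
before `∀ D` and its choice of the continuous branch `L` are forced, and only the holomorphy
clause of `IsPickCupLimit` (continuity of `g` on the open carrier) is used. [folklore] -/
theorem identification_of_hexObservableLimitR : HexObservableLimitR →
    ∃ c : ℂ, c ≠ 0 ∧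
    ∀ (D : DobrushinDomain) (ρ : ℝ) (Λ : ℝ → Finset HexVertex) (m : ℝ → ℤ) (b : ℝ → Sym2 HexVertex),
      (0 < ρ ∧
        D.carrier ∩ Metric.ball (D.pt 1) ρ = {z : ℂ | (D.pt 1).im < z.im} ∩ Metric.ball (D.pt 1) ρ ∧
        (∀ᶠ δ : ℝ in 𝓝[>] 0, hexDomainSimplyConnected (Λ δ) ∧ b δ ∈ hexDomainBoundary (Λ δ) ∧
            (hexGraph.induce ((Λ δ : Finset HexVertex) : Set HexVertex)).Preconnected ∧
            (∀ v ∈ Λ δ, (δ : ℂ) * hexCenter v ∈ D.carrier) ∧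
            (∀ v : HexVertex, (δ : ℂ) * hexCenter v ∈ Metric.ball (D.pt 1) ρ →
              (v ∈ Λ δ ↔ m δ ≤ v.1 1))) ∧
        (∀ K : Set ℂ, IsCompact K → K ⊆ D.carrier →
            ∀ᶠ δ : ℝ in 𝓝[>] 0, ∀ v : HexVertex, (δ : ℂ) * hexCenter v ∈ K → v ∈ Λ δ) ∧
        Tendsto (fun δ : ℝ => (δ : ℂ) * hexMidpoint (b δ)) (𝓝[>] 0) (𝓝 (D.pt 1))) →
    ∀ (a : ℝ → Sym2 HexVertex) (r₀ : ℝ) (m₀ : ℝ → ℤ),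
      (0 < r₀ ∧
        D.carrier ∩ Metric.ball (D.pt 0) r₀ = {z : ℂ | (D.pt 0).im < z.im} ∩ Metric.ball (D.pt 0) r₀ ∧
        (∀ᶠ δ : ℝ in 𝓝[>] 0, a δ ∈ hexDomainBoundary (Λ δ) ∧
            Nonempty (HexMidEdgeSAW (Λ δ) (a δ) (b δ)) ∧
            (∀ v : HexVertex, (δ : ℂ) * hexCenter v ∈ Metric.ball (D.pt 0) r₀ →
              (v ∈ Λ δ ↔ m₀ δ ≤ v.1 1))) ∧
        Tendsto (fun δ : ℝ => (δ : ℂ) * hexMidpoint (a δ)) (𝓝[>] 0) (𝓝 (D.pt 0))) →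
    ∀ (Φ : ConformalEquiv D.carrier UpperHalfPlane.upperHalfPlaneSet) (L : ℂ → ℂ) (Lb : ℂ),
      Tendsto (fun z => ‖Φ z‖) (𝓝[D.carrier] (D.pt 0)) atTop → Φ.HasBoundaryValue (D.pt 1) 0 →
      ContinuousOn L D.carrier → (∀ z ∈ D.carrier, Complex.exp (L z) = deriv Φ z) →
      Tendsto L (𝓝[D.carrier] (D.pt 1)) (𝓝 Lb) →
    ∀ ns : ℕ → ℝ, Tendsto ns atTop (𝓝[>] 0) →
    ∀ g : ℂ → ℂ,
      (DifferentiableOn ℂ g D.carrier ∧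
        (∃ κ : ℂ, κ ≠ 0 ∧
          Tendsto (fun z => g z * (z - D.pt 0) ^ ((5 : ℂ) / 4)) (𝓝[D.carrier] (D.pt 0)) (𝓝 κ)) ∧
        (∀ y ∈ ({z : ℂ | z.im = (D.pt 1).im} ∩ Metric.ball (D.pt 1) ρ) ∪
            ({z : ℂ | z.im = (D.pt 0).im} ∩ Metric.ball (D.pt 0) r₀),
          y ≠ D.pt 0 → ∃ w : ℂ, w ≠ 0 ∧ Tendsto g (𝓝[D.carrier] y) (𝓝 w))) →
      (∀ ψ : ℂ → ℂ, (Continuous ψ ∧ HasCompactSupport ψ ∧ tsupport ψ ⊆ D.carrier) →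
        Tendsto (fun n => ((ns n : ℝ) : ℂ) ^ 2 * (∑ᶠ z ∈ hexDomainMidEdges (Λ (ns n)),
            ψ (((ns n : ℝ) : ℂ) * hexMidpoint z) *
              hexParafermionicObservable (Λ (ns n)) (a (ns n)) hexCriticalFugacity (5 / 8) z) /
          hexParafermionicObservable (Λ (ns n)) (a (ns n)) hexCriticalFugacity (5 / 8) (b (ns n)))
          atTop (𝓝 (∫ z, ψ z * g z))) →
      ∀ z ∈ D.carrier, g z = c * Complex.exp ((5 / 8 : ℂ) * (L z - Lb)) := by
  rintro ⟨c, hc, hT⟩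
  refine ⟨c, hc, ?_⟩
  intro D ρ Λ m b hAF a r₀ m₀ hPR Φ L Lb hΦ hΦb hL hexpL hLb ns hns g hg hw
  exact weakLimit_eq_of_hexObservableLimitR hT D ρ Λ m b hAF a r₀ m₀ hPR Φ L Lb hΦ hΦb hL hexpL
    hLb ns hns g (hg.1.continuousOn) hw

end Summit.CriticalPhenomena.SAWScalingLimit.Theorems.PickHalfPlane.Identification

end
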